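/-
Copyright (c) 2026. All rights reserved.
Released under Apache 2.0 license as described in the file LICENSE.
-/
import Literature.AlgebraicGeometry.ComplexMultiplication.HyperellipticJacobianLevelFortyHodgeConjecture
import Literature.AlgebraicGeometry.HodgeTheory.WeilClassesSixfolds
import Literature.AlgebraicGeometry.VanGeemen1994.WeilDiscriminantSign
import HarnessLib

/-!
# `J_{40}` and MARKMAN's theorem on sixfolds of SPLIT Weil type: `HC(J(y² = x^{40} − 1))` — and the Hodge conjecture for every product of its
# CM pieces — follows from Markman 2025 Thm. 1.5.1 (arXiv:2502.03415, preprint; the tree's named fact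
# `Markman2025_weilClasses_algebraic_hyperbolicSixfold`) AS SOON AS the sixfold `Z = E' ⊕ E' ⊕ Y_{40}` of Weil type `(3, 2)` is of SPLIT Weil
# type (discriminant `[-1] ∈ ℚ^×/Nm(ℚ(√−2)^×)` for one `K`-symmetrised hyperplane class)

Layer `Literature/AlgebraicGeometry/ComplexMultiplication`, namespace `…HyperellipticJacobian.WeightedForty`; the sequel of
`HyperellipticJacobianLevelFortyHodgeConjecture` (F58d: `HC(J_{40})`, and HC of every product of the six CM pieces, ⟺ the rational `(3,3)` classes of
the Weil plane of `(Z, φ_a)`, `Z = E' ⊕ E' ⊕ Y_{40}`, `φ_a = ι(a_0) ⊕ ι(a_0) ⊕ ι(a_1)`, `φ_a² = −2`).  THEOREMS ONLY (no definition, no named fact, no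
`sorry`; D-0026 net debt `0`).  HONEST FRAMING: everything here is CONDITIONAL on (i) Markman's PREPRINT theorem, taken BY NAME as the hypothesis
`(hM : Markman2025_weilClasses_algebraic_hyperbolicSixfold)`, and (ii) a SPLIT datum for `Z` (`HodgeTheory.IsSplitWeilType Z φ_a 3 2`, equivalently a
van Geemen discriminant witness of class `[(-1)³]` for one `K`-symmetrised hyperplane class); (ii) is NOT typed here (see «What remains»).

## The print

* E. Markman, *Cycles on abelian 2n-folds of Weil type from secant sheaves on abelian n-folds*, arXiv:2502.03415 (2025) [`Markman2025SecantWeil`],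
  Thm. 1.5.1 (held `paper:arxiv-2502.03415`): «Let `d` be a positive integer. Set `K := ℚ(√-d)`. The Hodge-Weil classes of polarized abelian sixfolds of
  Weil type with complex multiplication by `K` and with discriminant `-1` are algebraic.»  = E. Markman, *Secant sheaves and Weil classes on abelian
  varieties*, arXiv:2509.23403 [`Markman2025SurveySecant`], Thm. 1.2 (held, p. 3 L71–L75): «The Weil classes for abelian fourfolds of Weil type and
  abelian sixfolds of split Weil type with complex multiplication by a quadratic imaginary number field `K` are algebraic.»; §11.5 Step 1 (p. 19 L20–L22):
  «The discriminant takes values in `ℚ^×/Nm_{K/ℚ}(K^×)` and is the coset of `(-1)ⁿ` if and only if the component parametrizes polarized abelian varieties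
  of split Weil type [deligne-milne]. We conclude that the Hodge Weil classes on all polarized abelian sixfolds of split Weil type are algebraic.»;
  Step 2 (L25): «The discriminant invariant of polarized abelian varieties with complex multiplication by the same field is multiplicative under cartesian
  products.»
* B. van Geemen [vanGeemen1994HodgeAV] Lemma 5.2, 5.4 and (5.4.1) («`H` is hyperbolic iff `a ∈ Nm(K^*)`», Landherr); P. Deligne [Deligne1982HodgeCycles]
  §4 Cor. 4.2.  In the tree: `HodgeTheory.IsSplitWeilType` (a hyperbolic `K`-symmetrised hyperplane class), `VanGeemen1994.HasWeilDiscriminantNondeg`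
  (a discriminant witness), Landherr's criterion on the carriers (`VanGeemen1994.isHyperbolicWeilType_of_hasWeilDiscriminantNondeg_split`) and the sign of
  the discriminant of a Weil-type pair (`neg_one_pow_mul_pos_of_hasWeilDiscriminantNondeg_of_isWeilType`).
* B. Moonen, Yu. Zarhin [MoonenZarhin1999LowDim] §5 Case 2; A. Gallese, H. Goodson, D. Lombardo [GalleseGoodsonLombardo2024] §3 Thm. 3.0, §3.5.

## What is proved

* §1 (any `(A, φ)`): **`weilClasses_algebraic_of_markman_of_isSplitWeilType`** — Markman's fact, by name, makes every rational `(3,3)` class of the Weil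
  plane of a sixfold of SPLIT Weil type `(3, d)` algebraic (the fact's hypotheses `dim = 6`, smooth projective, `φ² = −d`, a hyperbolic `K`-symmetrised
  hyperplane class are exactly the content of `IsSplitWeilType A φ 3 d`); **`isSplitWeilType_of_hasWeilDiscriminantNondeg_neg`** — for a Weil-type
  `(A, φ, 3, d)` a discriminant witness of class `[-t²]` (`t ∈ ℚ^×`) for one `K`-symmetrised hyperplane class gives the split type (van Geemen (5.4.1) ⟸,
  Landherr; the tree's `isSplitWeilType_of_hasWeilDiscriminantNondeg_sq` at `n = 3`).
* §2 (the pair `E' ⊨ (L_8; Ψ_8)`, `Y_{40} ⊨ (L_{40}; Ψ_{40})`): **`exists_neg_hasWeilDiscriminantNondeg_sixfold`** — WHAT REMAINS, made precise: for every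
  projective embedding `e` of `Z` and rational `a ≠ 0` the `K`-symmetrised hyperplane class `2·e^*a + φ_a^*e^*a` has a unique discriminant class, of the
  form `[-q]` with `q > 0` (the pair is of Weil type `(3,3)`, F58c); `Z` is split iff some such `q` is a norm from `ℚ(√−2)`;
  **`weilClasses_sixfold_algebraic_of_markman_of_isSplitWeilType`** — given Markman's fact and the split datum, the rational `(3,3)` classes of the Weil
  plane of `Z` are algebraic; hence (**`hodgeConjectureFor_prod_of_markman_of_isSplitWeilType`**) `HC(E'^a × Y_{40}^c)` for all `a, c`.
* §3 (the `J_{40}`-family of F58d §4): **`hodgeConjectureFor_biproduct_forty_of_markman_of_isSplitWeilType`** — `HC(J_{40})`;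
  **`hodgeConjectureFor_of_isIsogenous_prod_forty_of_markman_of_isSplitWeilType`** — HC for every `X` isogenous to a product of the CM pieces
  `X_4, X_5, X_{10}, X_{20}, X_8, X_{40}` of `J_{40}`; both GIVEN Markman's fact and the split datum on `Z`.

WHAT REMAINS (recorded, not typed).  The split datum for `Z` is expected to hold: the discriminant is multiplicative over `Z = E' × E' × Y_{40}`
(Markman §11.5 Step 2; the tree's `VanGeemen1994.hasWeilDiscriminantNondeg_prod_of_kFrames`), the `K`-Hermitian line of the CM elliptic curve `E'` may be
rescaled by any positive rational (its polarization is unique up to `ℚ_{>0}`), so a product polarization `(q·θ_{E'}, θ_{E'}, θ_Y)` with `q ≡ |det H_Y|`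
has `|det H_Z|` a square, i.e. `det H_Z ≡ (-1)³` — `Z` is of split Weil type for it (Landherr).  Typing this needs the `K`-symmetric Segre embedding of
`Y_{40} × (E' × E')` with prescribed weights (`Motives.exists_symmetricSegreEmbedding`), rational degree-one models of the three factors
(`Motives.exists_rationalModel_one`, the CM-curve model), the product formula, and the transport of the Weil plane from `Y_{40} × (E' × E')` to the
biproduct `Z` (`HodgeTheory.weilClassesOf_map_eq_of_isIsogeny_of_comm`); it is left to the next generation of this lane.  HC_CM is NOT proved; no Weil
class is asserted algebraic except through `hM` and the split datum.

## References

* [Markman2025SecantWeil] E. Markman, arXiv:2502.03415 (2025) — §1.1, Thm. 1.5.1, Lemma 3.1.3. [cite: Markman2025SecantWeil, Thm. 1.5.1]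
* [Markman2025SurveySecant] E. Markman, arXiv:2509.23403 (2025) — Thm. 1.2, §11.5 Steps 1–2. [cite: Markman2025SurveySecant, Thm. 1.2 and §11.5 Steps 1–2]
* [vanGeemen1994HodgeAV] B. van Geemen, LNM 1594 (1994) — 4.9, Lemma 5.2, 5.4 and (5.4.1), Thm. 6.12. [cite: vanGeemen1994HodgeAV, Lemma 5.2, 5.4 and (5.4.1)]
* [Deligne1982HodgeCycles] P. Deligne, LNM 900 (1982) — §4 Prop. 4.1, Cor. 4.2, Prop. 4.4. [cite: Deligne1982HodgeCycles, §4 Cor. 4.2]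
* [Landherr1936HermitianForms] W. Landherr, Abh. Math. Sem. Hamburg 11 (1936). [cite: Landherr1936HermitianForms]
* [MoonenZarhin1999LowDim] B. Moonen, Yu. Zarhin, Math. Ann. 315 (1999) — §5 Case 2, §3 (3.1). [cite: MoonenZarhin1999LowDim, §5 Case 2]
* [GalleseGoodsonLombardo2024] A. Gallese, H. Goodson, D. Lombardo, arXiv:2405.20394 — §3 Thm. 3.0, §3.5. [cite: GalleseGoodsonLombardo2024, §3 Thm. 3.0 and §3.5]

## Provenance

Cell `pub-hodgecm2` (COR-CM), KEPT Literature lane `lit-deligne-3` gen 58 (claim MZ99-J40-MARKMAN-SPLIT-REDUCTION; count-neutral, own lane), file F58e.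
-/

noncomputable section

open CategoryTheory CategoryTheory.Limits NumberField Module

namespace Literature.AlgebraicGeometry.ComplexMultiplication

open Literature.AlgebraicGeometry.Motives
open Literature.AlgebraicGeometry.Motives.AbelianVariety
open Literature.AlgebraicTopology.SingularHomology
open Literature.AlgebraicGeometry.HodgeTheory (complexBetti IsRationalClass IsOfHodgeType HodgeConjectureFor IsWeilType IsSplitWeilType weilClassesOf
  algebraicClasses IsStablyNondegenerate Markman2025_weilClasses_algebraic_hyperbolicSixfold exists_isRationalClass_ne_zero_mem_weilClassesOf)
open Literature.AlgebraicGeometry.VanGeemen1994 (HasWeilDiscriminantNondeg weilNormResidueGroup existsUnique_hasWeilDiscriminantNondeg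
  neg_one_pow_mul_pos_of_hasWeilDiscriminantNondeg_of_isWeilType isSplitWeilType_of_hasWeilDiscriminantNondeg_sq)
open Literature.NumberTheory.ComplexMultiplication
open Literature.AlgebraicGeometry.ComplexMultiplication.CMWeights

namespace HyperellipticJacobian

namespace WeightedForty

open Literature.AlgebraicGeometry.Pohlmann1968 Literature.AlgebraicGeometry.Pohlmann1968.Cyclotomic
open Literature.AlgebraicGeometry.Pohlmann1968.CMAlgebra

open scoped Classical

/-! ## §1 Markman's fact on a sixfold of SPLIT Weil type; split from a discriminant witness of class `[-t²]` -/

section Generic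

variable {A : AbelianVariety ℂ} {φ : A ⟶ A} {d : ℕ}

/-- **MARKMAN 2025 Thm. 1.5.1 ON A SIXFOLD OF SPLIT WEIL TYPE, by name**: if `(A, φ)` is of split Weil type `(3, d)` (`HodgeTheory.IsSplitWeilType`:
Weil type `(3,3)`, `φ² = −d`, and SOME `K`-symmetrised hyperplane class `d·e^*a + φ^*e^*a` is hyperbolic — discriminant `[(-1)³]`, van Geemen (5.4.1)),
then, GIVEN the fact `Markman2025_weilClasses_algebraic_hyperbolicSixfold`, every rational class of Hodge type `(3,3)` of the Weil plane
`weilClassesOf A φ 3 d` is algebraic. [cite: Markman2025SecantWeil, Thm. 1.5.1] [cite: Markman2025SurveySecant, Thm. 1.2 and §11.5 Step 1]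
[cite: vanGeemen1994HodgeAV, 5.4 and (5.4.1)] -/
theorem weilClasses_algebraic_of_markman_of_isSplitWeilType (hM : Markman2025_weilClasses_algebraic_hyperbolicSixfold)
    (hS : IsSplitWeilType A φ 3 d) :
    ∀ c ∈ weilClassesOf A φ 3 d, IsRationalClass c → IsOfHodgeType (2 * 3) A.X (2 * 3) 3 3 c → c ∈ algebraicClasses A.X 3 := by
  obtain ⟨hW, e, a, ha, ha0, hhyp⟩ := hS
  intro c hcW hcQ hcH
  exact hM d hW.d_pos A φ hW.dim_eq hW.isSmoothProjective hW.sq_eq e a ha ha0 hhyp c hcQ hcH hcW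

/-- **SPLIT FROM A DISCRIMINANT WITNESS OF CLASS `[-t²]`** (van Geemen (5.4.1) ⟸ ∕ Landherr, on the carriers; `n = 3`, `(-1)³ = −1`): a Weil-type
`(A, φ, 3, d)` one of whose `K`-symmetrised hyperplane classes has a non-degenerate discriminant witness of class `[(-1)³ · t²]`, `t ∈ ℚ^×`, is of split
Weil type. [cite: vanGeemen1994HodgeAV, Lemma 5.2 (2)–(4), 5.4 and (5.4.1)] [cite: Landherr1936HermitianForms] [cite: Deligne1982HodgeCycles, §4 Cor. 4.2] -/
theorem isSplitWeilType_of_hasWeilDiscriminantNondeg_neg (hW : IsWeilType A φ 3 d) (e : ProjectiveEmbedding A.X)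
    {a : complexBetti (projectiveSpace e.n ℂ) 2} (ha : IsRationalClass a) (ha0 : a ≠ 0) {t : ℚ} (ht : t ≠ 0)
    (hδ : HasWeilDiscriminantNondeg A φ 3 d
      ((d : ℂ) • complexBetti.map e.ι 2 a + complexBetti.map φ.hom.hom.hom 2 (complexBetti.map e.ι 2 a))
      (QuotientGroup.mk ((-1 : ℚˣ) ^ 3 * Units.mk0 (t ^ 2) (pow_ne_zero 2 ht)))) :
    IsSplitWeilType A φ 3 d :=
  isSplitWeilType_of_hasWeilDiscriminantNondeg_sq hW e ha ha0 ht hδ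

end Generic

/-! ## §2 The sixfold `Z = E' ⊕ E' ⊕ Y_{40}`: what remains (one norm-residue class), and the Weil plane GIVEN Markman's fact and the split datum -/

section Pair

variable {lev : Fin 2 → ℕ} [∀ i, NeZero (lev i)] {K : Fin 2 → Type} [∀ i, Field (K i)] [∀ i, NumberField (K i)]
  [∀ i, IsCyclotomicExtension {lev i} ℚ (K i)] {Φ : ∀ i, CMType (K i)}
  {L : ∀ i, IntermediateField ℚ (K i)} {Ψ : ∀ i, CMType (L i)}
  {B : Fin 2 → AbelianVariety ℂ} {ιB : ∀ i, 𝓞 (L i) →+* End (B i)} {θB : ∀ i, L i →+* Module.End ℂ (complexBetti (B i).X 1)}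

set_option maxHeartbeats 1000000 in -- the dependent slot family `L (![0, 0, 1] j)` makes unification slow
/-- **WHAT REMAINS FOR `J_{40}`, MADE PRECISE: ONE NORM-RESIDUE CLASS.**  For every projective embedding `e` of `Z = E' ⊕ E' ⊕ Y_{40}` and every rational
`a ≠ 0` on `ℙᴺ`, the `K`-symmetrised hyperplane class `2·e^*a + φ_a^*e^*a` has a UNIQUE van Geemen discriminant class, and it is `[-q]` for a rational
`q > 0` (`(Z, φ_a)` is of Weil type `(3,3)`, F58c; van Geemen (5.4.1): the class of a Weil-type pair is `[(-1)ⁿ a]`, `a > 0`).  `Z` is of split Weil type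
iff, for some `(e, a)`, this `q` is a norm from `ℚ(√−2)`. [cite: vanGeemen1994HodgeAV, Lemma 5.2 (1)–(3), 5.4 and (5.4.1)] [cite: MoonenZarhin1999LowDim, §5 Case 2]
[cite: Markman2025SurveySecant, §11.5 Step 1] -/
theorem exists_neg_hasWeilDiscriminantNondeg_sixfold (h0 : lev 0 = 8) (h1 : lev 1 = 40)
    (hΦ : ∀ i (σ : K i →+* ℂ), σ ∈ (Φ i).1 ↔ 2 * (expOf (lev i) (K i) σ).val < lev i)
    (hind : ∀ i, inducedCMType (algebraMap (L i) (K i)) (Ψ i) = Φ i) (hfin : ∀ i, Module.finrank (L i) (K i) = 2) (a : ∀ i, 𝓞 (L i))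
    (ha : ∀ i, (((a i : L i)) : K i) = zetaOf (lev i) (K i) ^ ((![7, 5] : Fin 2 → ℕ) i) - (zetaOf (lev i) (K i) ^ ((![7, 5] : Fin 2 → ℕ) i))⁻¹)
    (hB : ∀ i, IsCMTypeRealisation (Ψ i) (B i) (ιB i) (θB i))
    (e : ProjectiveEmbedding (⨁ fun j : Fin 3 => B ((![0, 0, 1] : Fin 3 → Fin 2) j)).X) {r : complexBetti (projectiveSpace e.n ℂ) 2}
    (hr : IsRationalClass r) (hr0 : r ≠ 0) :
    ∃ q : ℚˣ, 0 < (q : ℚ) ∧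
      HasWeilDiscriminantNondeg (⨁ fun j : Fin 3 => B ((![0, 0, 1] : Fin 3 → Fin 2) j))
        (biproduct.map fun j : Fin 3 => ιB ((![0, 0, 1] : Fin 3 → Fin 2) j) (a ((![0, 0, 1] : Fin 3 → Fin 2) j))) 3 2
        (((2 : ℕ) : ℂ) • complexBetti.map e.ι 2 r +
          complexBetti.map (biproduct.map fun j : Fin 3 => ιB ((![0, 0, 1] : Fin 3 → Fin 2) j) (a ((![0, 0, 1] : Fin 3 → Fin 2) j))).hom.hom.hom 2
            (complexBetti.map e.ι 2 r))
        (QuotientGroup.mk (-q)) ∧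
      ∀ δ : weilNormResidueGroup 2,
        HasWeilDiscriminantNondeg (⨁ fun j : Fin 3 => B ((![0, 0, 1] : Fin 3 → Fin 2) j))
          (biproduct.map fun j : Fin 3 => ιB ((![0, 0, 1] : Fin 3 → Fin 2) j) (a ((![0, 0, 1] : Fin 3 → Fin 2) j))) 3 2
          (((2 : ℕ) : ℂ) • complexBetti.map e.ι 2 r +
            complexBetti.map (biproduct.map fun j : Fin 3 => ιB ((![0, 0, 1] : Fin 3 → Fin 2) j) (a ((![0, 0, 1] : Fin 3 → Fin 2) j))).hom.hom.hom 2
              (complexBetti.map e.ι 2 r)) δ → δ = QuotientGroup.mk (-q) := by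
  have hWT := isWeilType_sixfold h0 h1 hΦ hind hfin a ha hB
  obtain ⟨δ, hδ, huniq⟩ := existsUnique_hasWeilDiscriminantNondeg hWT.pos hWT.dim_eq hWT.d_pos hWT.sq_eq e hr hr0
  obtain ⟨q₀, rfl⟩ := QuotientGroup.mk_surjective δ
  have hsign := neg_one_pow_mul_pos_of_hasWeilDiscriminantNondeg_of_isWeilType hWT e hr hr0 hδ
  have hq₀ : (q₀ : ℚ) < 0 := by
    have h : (-1 : ℚ) ^ 3 * (q₀ : ℚ) = -(q₀ : ℚ) := by norm_num
    rw [h] at hsign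
    linarith
  refine ⟨-q₀, by simp only [Units.val_neg]; linarith, by rw [neg_neg]; exact hδ, fun δ' hδ' => ?_⟩
  rw [neg_neg]
  exact huniq δ' hδ'

set_option maxHeartbeats 1000000 in -- the dependent slot family `L (![0, 0, 1] j)` makes unification slow
/-- **THE WEIL PLANE OF `Z` GIVEN MARKMAN'S FACT AND THE SPLIT DATUM**: if `(Z, φ_a)` is of split Weil type (discriminant `[-1]` for one `K`-symmetrised
hyperplane class), then Markman's theorem (by name) makes the rational `(3,3)` classes of its Weil plane algebraic — the hypothesis `hW` of F58c∕F58d.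
[cite: Markman2025SecantWeil, Thm. 1.5.1] [cite: MoonenZarhin1999LowDim, §5 Case 2] [cite: vanGeemen1994HodgeAV, 5.4 and (5.4.1)] -/
theorem weilClasses_sixfold_algebraic_of_markman_of_isSplitWeilType (hM : Markman2025_weilClasses_algebraic_hyperbolicSixfold) (a : ∀ i, 𝓞 (L i))
    (hS : IsSplitWeilType (⨁ fun j : Fin 3 => B ((![0, 0, 1] : Fin 3 → Fin 2) j))
      (biproduct.map fun j : Fin 3 => ιB ((![0, 0, 1] : Fin 3 → Fin 2) j) (a ((![0, 0, 1] : Fin 3 → Fin 2) j))) 3 2) :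
    ∀ c ∈ weilClassesOf (⨁ fun j : Fin 3 => B ((![0, 0, 1] : Fin 3 → Fin 2) j))
        (biproduct.map fun j : Fin 3 => ιB ((![0, 0, 1] : Fin 3 → Fin 2) j) (a ((![0, 0, 1] : Fin 3 → Fin 2) j))) 3 2,
      IsRationalClass c → IsOfHodgeType (2 * 3) (⨁ fun j : Fin 3 => B ((![0, 0, 1] : Fin 3 → Fin 2) j)).X (2 * 3) 3 3 c →
        c ∈ algebraicClasses (⨁ fun j : Fin 3 => B ((![0, 0, 1] : Fin 3 → Fin 2) j)).X 3 :=
  weilClasses_algebraic_of_markman_of_isSplitWeilType hM hS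

set_option maxHeartbeats 1000000 in -- the dependent slot family `L (![0, 0, 1] j)` makes unification slow
/-- **`HC(E'^a × Y_{40}^c)` FOR ALL `a, c`, GIVEN MARKMAN'S FACT AND THE SPLIT DATUM ON `Z`** (F58c's equivalence fed by §2).
[cite: MoonenZarhin1999LowDim, Thm. 0.2 (3) and §5 Case 2] [cite: Markman2025SecantWeil, Thm. 1.5.1] [cite: vanGeemen1994HodgeAV, 1.1 and Thm. 4.11] -/
theorem hodgeConjectureFor_prod_of_markman_of_isSplitWeilType (hM : Markman2025_weilClasses_algebraic_hyperbolicSixfold)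
    (h0 : lev 0 = 8) (h1 : lev 1 = 40) (hΦ : ∀ i (σ : K i →+* ℂ), σ ∈ (Φ i).1 ↔ 2 * (expOf (lev i) (K i) σ).val < lev i)
    (hind : ∀ i, inducedCMType (algebraMap (L i) (K i)) (Ψ i) = Φ i) (hfin : ∀ i, Module.finrank (L i) (K i) = 2) (a : ∀ i, 𝓞 (L i))
    (ha : ∀ i, (((a i : L i)) : K i) = zetaOf (lev i) (K i) ^ ((![7, 5] : Fin 2 → ℕ) i) - (zetaOf (lev i) (K i) ^ ((![7, 5] : Fin 2 → ℕ) i))⁻¹)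
    (hB : ∀ i, IsCMTypeRealisation (Ψ i) (B i) (ιB i) (θB i)) (hs : (B 1).IsSimple) (hst : IsStablyNondegenerate (B 1))
    (hS : IsSplitWeilType (⨁ fun j : Fin 3 => B ((![0, 0, 1] : Fin 3 → Fin 2) j))
      (biproduct.map fun j : Fin 3 => ιB ((![0, 0, 1] : Fin 3 → Fin 2) j) (a ((![0, 0, 1] : Fin 3 → Fin 2) j))) 3 2)
    (N : ℕ) (π : Fin N → Fin 2) : HodgeConjectureFor (⨁ fun j => B (π j)).dim (⨁ fun j => B (π j)).X :=
  hodgeConjectureFor_prod_of_weilClasses_algebraic h0 h1 hΦ hind hfin a ha hB hs hst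
    (weilClasses_sixfold_algebraic_of_markman_of_isSplitWeilType hM a hS) N π

end Pair

/-! ## §3 The `J_{40}`-family: `HC(J_{40})` and every product of its CM pieces, GIVEN Markman's fact and the split datum -/

section Family

variable {κ : Type} {lev : κ → ℕ} [∀ j, NeZero (lev j)] {F : κ → Type} [∀ j, Field (F j)] [∀ j, NumberField (F j)]
  [∀ j, IsCyclotomicExtension {lev j} ℚ (F j)] {Λ : ∀ j, CMType (F j)} {C : κ → AbelianVariety ℂ}
  {ιC : ∀ j, 𝓞 (F j) →+* End (C j)} {θC : ∀ j, F j →+* Module.End ℂ (complexBetti (C j).X 1)}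
  {v : Fin 2 → κ} {L : ∀ i, IntermediateField ℚ (F (v i))} {Ψ : ∀ i, CMType (L i)} {B : Fin 2 → AbelianVariety ℂ}
  {ιB : ∀ i, 𝓞 (L i) →+* End (B i)} {θB : ∀ i, L i →+* Module.End ℂ (complexBetti (B i).X 1)}

/-- **`HC(J(y² = x^{40} − 1))` GIVEN MARKMAN'S FACT AND THE SPLIT DATUM ON `Z = E' ⊕ E' ⊕ Y_{40}`** (`J_{40}` = the biproduct `⨁_j C_j` of the Thm.-3.0
decomposition, read as hypothesis; F58d's equivalence fed by §2). [cite: GalleseGoodsonLombardo2024, §3 Thm. 3.0 and §3.5] [cite: Markman2025SecantWeil, Thm. 1.5.1]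
[cite: MoonenZarhin1999LowDim, §5 Case 2 and §3 (3.1)] -/
theorem hodgeConjectureFor_biproduct_forty_of_markman_of_isSplitWeilType [Fintype κ] [DecidableEq κ]
    (hM : Markman2025_weilClasses_algebraic_hyperbolicSixfold) (hlev : ∀ d, (∃ j, lev j = d) ↔ d ∣ 40 ∧ 3 ≤ d) (hinj : Function.Injective lev)
    (hΛ : ∀ j (σ : F j →+* ℂ), σ ∈ (Λ j).1 ↔ 2 * (expOf (lev j) (F j) σ).val < lev j) (hC : ∀ j, IsCMTypeRealisation (Λ j) (C j) (ιC j) (θC j))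
    (hv0 : lev (v 0) = 8) (hv1 : lev (v 1) = 40) (hind : ∀ i, inducedCMType (algebraMap (L i) (F (v i))) (Ψ i) = Λ (v i))
    (hfin : ∀ i, Module.finrank (L i) (F (v i)) = 2) (hB : ∀ i, IsCMTypeRealisation (Ψ i) (B i) (ιB i) (θB i)) (hs : (B 1).IsSimple)
    (hst : IsStablyNondegenerate (B 1)) (hiso : ∀ i, IsIsogenous (C (v i)) (⨁ fun _ : Fin 2 => B i)) (a : ∀ i, 𝓞 (L i))
    (ha : ∀ i, (((a i : L i)) : F (v i)) =
      zetaOf (lev (v i)) (F (v i)) ^ ((![7, 5] : Fin 2 → ℕ) i) - (zetaOf (lev (v i)) (F (v i)) ^ ((![7, 5] : Fin 2 → ℕ) i))⁻¹)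
    (h8 : ∀ j, lev j = 8 → j = v 0) (h40 : ∀ j, lev j = 40 → j = v 1)
    (hS : IsSplitWeilType (⨁ fun j : Fin 3 => B ((![0, 0, 1] : Fin 3 → Fin 2) j))
      (biproduct.map fun j : Fin 3 => ιB ((![0, 0, 1] : Fin 3 → Fin 2) j) (a ((![0, 0, 1] : Fin 3 → Fin 2) j))) 3 2) :
    HodgeConjectureFor (⨁ C).dim (⨁ C).X :=
  (hodgeConjectureFor_biproduct_forty_iff hlev hinj hΛ hC hv0 hv1 hind hfin hB hs hst hiso a ha h8 h40).2
    (weilClasses_sixfold_algebraic_of_markman_of_isSplitWeilType hM a hS)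

/-- **… AND THE HODGE CONJECTURE FOR EVERY `X` ISOGENOUS TO A PRODUCT OF THE CM PIECES `X_4, X_5, X_{10}, X_{20}, X_8, X_{40}` OF `J_{40}`** (all
`J_{40}ⁿ` included), GIVEN Markman's fact and the split datum. [cite: GalleseGoodsonLombardo2024, §3 Thm. 3.0 and §3.5] [cite: Markman2025SecantWeil, Thm. 1.5.1]
[cite: MoonenZarhin1999LowDim, §3 (3.1) and §5 Case 2] -/
theorem hodgeConjectureFor_of_isIsogenous_prod_forty_of_markman_of_isSplitWeilType [Fintype κ] [DecidableEq κ]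
    (hM : Markman2025_weilClasses_algebraic_hyperbolicSixfold) (hlev : ∀ d, (∃ j, lev j = d) ↔ d ∣ 40 ∧ 3 ≤ d) (hinj : Function.Injective lev)
    (hΛ : ∀ j (σ : F j →+* ℂ), σ ∈ (Λ j).1 ↔ 2 * (expOf (lev j) (F j) σ).val < lev j) (hC : ∀ j, IsCMTypeRealisation (Λ j) (C j) (ιC j) (θC j))
    (hv0 : lev (v 0) = 8) (hv1 : lev (v 1) = 40) (hind : ∀ i, inducedCMType (algebraMap (L i) (F (v i))) (Ψ i) = Λ (v i))
    (hfin : ∀ i, Module.finrank (L i) (F (v i)) = 2) (hB : ∀ i, IsCMTypeRealisation (Ψ i) (B i) (ιB i) (θB i)) (hs : (B 1).IsSimple)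
    (hst : IsStablyNondegenerate (B 1)) (hiso : ∀ i, IsIsogenous (C (v i)) (⨁ fun _ : Fin 2 => B i)) (a : ∀ i, 𝓞 (L i))
    (ha : ∀ i, (((a i : L i)) : F (v i)) =
      zetaOf (lev (v i)) (F (v i)) ^ ((![7, 5] : Fin 2 → ℕ) i) - (zetaOf (lev (v i)) (F (v i)) ^ ((![7, 5] : Fin 2 → ℕ) i))⁻¹)
    (h8 : ∀ j, lev j = 8 → j = v 0) (h40 : ∀ j, lev j = 40 → j = v 1)
    (hS : IsSplitWeilType (⨁ fun j : Fin 3 => B ((![0, 0, 1] : Fin 3 → Fin 2) j))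
      (biproduct.map fun j : Fin 3 => ιB ((![0, 0, 1] : Fin 3 → Fin 2) j) (a ((![0, 0, 1] : Fin 3 → Fin 2) j))) 3 2)
    {ι : Type} [Fintype ι] (f : ι → κ) {X : AbelianVariety ℂ} (hX : IsIsogenous X (⨁ fun i => C (f i))) : HodgeConjectureFor X.dim X.X :=
  hodgeConjectureFor_of_isIsogenous_prod_forty_of_weilClasses_algebraic hlev hinj hΛ hC hv0 hv1 hind hfin hB hs hst hiso a ha h8 h40
    (weilClasses_sixfold_algebraic_of_markman_of_isSplitWeilType hM a hS) f hX

end Family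

end WeightedForty

end HyperellipticJacobian

end Literature.AlgebraicGeometry.ComplexMultiplication

end
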